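import Mathlib.Analysis.InnerProductSpace.Spectrum
import Mathlib.Analysis.InnerProductSpace.PiL2
import HarnessLib

/-!
# Frame relaxation of weak-trace bounds (Ky Fan), abstract form

Cell `rh-explicit`, seat cc-s2-1 (HOME `run/shared/lean/pub/rh-explicit/`).  The semilocal operator obligations of the
cell (`SemilocalSoninIneqOn p a`) bound `Σ_i Re⟨e_i | ϑ(k) e_i⟩ ≤ C` over finite ORTHONORMAL families `e_i` of a closed
subspace `𝔖`.  A finite numerical certificate against such a bound naturally produces a finite family `v_i ∈ 𝔖` that
is only NEARLY orthonormal (its vectors are Sonin projections of explicit near-vectors).  This file proves the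
relaxation that makes orthonormalisation unnecessary:

* `exists_orthonormal_sum_ge_of_frame` (finite-dimensional core): on a finite-dimensional complex inner product space,
  for a symmetric operator `T` and a FRAME `v_1, …, v_m` (`Σ_i |⟪v_i, x⟫|² ≤ ‖x‖²` for all `x`), there is an
  orthonormal family `e` with `Σ_i Re⟪v_i, T v_i⟫ ≤ Σ_j Re⟪e_j, T e_j⟫` (Ky Fan: `Σ_i ⟪v_i, T v_i⟫ = Σ_j μ_j w_j` with
  eigenvalues `μ_j` and weights `0 ≤ w_j ≤ 1`; keep the eigenvectors with `μ_j > 0`);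
* `exists_isSymmetric_inner_eq` : a conjugate-symmetric form `s`, additive and homogeneous in its second argument,
  is represented on every finite-dimensional subspace `W` by a symmetric operator (`⟪x, T y⟫ = s x y`);
* `frame_sum_le_of_orthonormal_sum_le` : hence a bound `Σ_i Re s(e_i, e_i) ≤ C` over finite orthonormal families of
  a subspace `S` extends to every finite frame of `S`;
* `frame_of_gershgorin` : the frame condition follows from the Gershgorin row test on the Gram matrix,
  `Σ_j |⟪v_i, v_j⟫| ≤ 1` for every `i` — so a certificate only rescales its section, it never inverts a Gram matrix.

Proof-only file (no definitions, no named facts). [folklore]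
-/

set_option linter.dupNamespace false  -- the mandated namespace repeats `RiemannHypothesis`

noncomputable section

open Finset Module
open scoped InnerProductSpace ComplexConjugate

namespace Summit.RiemannHypothesis.RiemannHypothesis.SoninFrame

/-! ## Finite-dimensional core (Ky Fan) -/

section Core

variable {W : Type*} [NormedAddCommGroup W] [InnerProductSpace ℂ W] [FiniteDimensional ℂ W]

/-- Diagonalisation of the quadratic form of a symmetric operator in its eigenbasis:
`⟪x, T x⟫ = Σ_j μ_j |⟪b_j, x⟫|²`. [folklore] -/
theorem inner_apply_eq_sum_eigenvalues {T : W →ₗ[ℂ] W} (hT : T.IsSymmetric) {d : ℕ} (hd : finrank ℂ W = d)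
    (x : W) :
    ⟪x, T x⟫_ℂ = ∑ j, ((hT.eigenvalues hd j : ℝ) : ℂ) * (‖⟪hT.eigenvectorBasis hd j, x⟫_ℂ‖ ^ 2 : ℝ) := by
  set b := hT.eigenvectorBasis hd with hb
  rw [← b.sum_inner_mul_inner x (T x)]
  refine Finset.sum_congr rfl fun j _ ↦ ?_
  have h1 : ⟪b j, T x⟫_ℂ = (hT.eigenvalues hd j : ℂ) * ⟪b j, x⟫_ℂ := by
    rw [← hT (b j) x, hb, hT.apply_eigenvectorBasis hd j, inner_smul_left, RCLike.conj_ofReal]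
    rfl
  rw [h1, ← inner_conj_symm x (b j)]
  have h2 : conj ⟪b j, x⟫_ℂ * ⟪b j, x⟫_ℂ = ((‖⟪b j, x⟫_ℂ‖ ^ 2 : ℝ) : ℂ) := by
    rw [Complex.conj_mul' ]
    push_cast; rfl
  calc conj ⟪b j, x⟫_ℂ * ((hT.eigenvalues hd j : ℂ) * ⟪b j, x⟫_ℂ)
      = (hT.eigenvalues hd j : ℂ) * (conj ⟪b j, x⟫_ℂ * ⟪b j, x⟫_ℂ) := by ring
    _ = _ := by rw [h2]

/-- Real part of the previous identity: `Re⟪x, T x⟫ = Σ_j μ_j |⟪b_j, x⟫|²`. [folklore] -/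
theorem re_inner_apply_eq_sum_eigenvalues {T : W →ₗ[ℂ] W} (hT : T.IsSymmetric) {d : ℕ} (hd : finrank ℂ W = d)
    (x : W) :
    (⟪x, T x⟫_ℂ).re = ∑ j, hT.eigenvalues hd j * ‖⟪hT.eigenvectorBasis hd j, x⟫_ℂ‖ ^ 2 := by
  rw [inner_apply_eq_sum_eigenvalues hT hd x, Complex.re_sum]
  refine Finset.sum_congr rfl fun j _ ↦ ?_
  rw [← Complex.ofReal_mul, Complex.ofReal_re]

/-- The diagonal coefficient of an eigenvector: `Re⟪b_j, T b_j⟫ = μ_j`. [folklore] -/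
theorem re_inner_eigenvectorBasis_apply {T : W →ₗ[ℂ] W} (hT : T.IsSymmetric) {d : ℕ} (hd : finrank ℂ W = d)
    (j : Fin d) :
    (⟪hT.eigenvectorBasis hd j, T (hT.eigenvectorBasis hd j)⟫_ℂ).re = hT.eigenvalues hd j := by
  rw [hT.apply_eigenvectorBasis hd j, inner_smul_right, (hT.eigenvectorBasis hd).inner_eq_one j]
  simp

/-- **Ky Fan frame relaxation (finite-dimensional core).**  For a symmetric operator `T` and a frame
`v_1, …, v_m` (`Σ_i |⟪v_i, x⟫|² ≤ ‖x‖²` for all `x`) there is an orthonormal family `e` with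
`Σ_i Re⟪v_i, T v_i⟫ ≤ Σ_j Re⟪e_j, T e_j⟫`. [folklore] -/
theorem exists_orthonormal_sum_ge_of_frame {T : W →ₗ[ℂ] W} (hT : T.IsSymmetric) {m : ℕ} (v : Fin m → W)
    (hframe : ∀ x : W, ∑ i, ‖⟪v i, x⟫_ℂ‖ ^ 2 ≤ ‖x‖ ^ 2) :
    ∃ (r : ℕ) (e : Fin r → W), Orthonormal ℂ e ∧
      ∑ i, (⟪v i, T (v i)⟫_ℂ).re ≤ ∑ j, (⟪e j, T (e j)⟫_ℂ).re := by
  set d := finrank ℂ W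
  have hd : finrank ℂ W = d := rfl
  set b := hT.eigenvectorBasis hd with hb
  set μ := hT.eigenvalues hd with hμ
  -- weights
  set w : Fin d → ℝ := fun j ↦ ∑ i, ‖⟪b j, v i⟫_ℂ‖ ^ 2 with hw
  have hw0 : ∀ j, 0 ≤ w j := fun j ↦ Finset.sum_nonneg fun i _ ↦ by positivity
  have hw1 : ∀ j, w j ≤ 1 := fun j ↦ by
    have h := hframe (b j)
    rw [b.orthonormal.1 j, one_pow] at h
    refine le_trans (le_of_eq (Finset.sum_congr rfl fun i _ ↦ ?_)) h
    rw [← inner_conj_symm, Complex.norm_conj]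
  -- the sum as Σ μ_j w_j
  have hsum : ∑ i, (⟪v i, T (v i)⟫_ℂ).re = ∑ j, μ j * w j := by
    simp_rw [re_inner_apply_eq_sum_eigenvalues hT hd, hw, Finset.mul_sum]
    exact Finset.sum_comm
  -- the positive eigenvalues
  let J := {j : Fin d // 0 < μ j}
  set r := Fintype.card J
  let φ : Fin r ≃ J := (Fintype.equivFin J).symm
  refine ⟨r, fun i ↦ b (φ i), b.orthonormal.comp _ (Subtype.val_injective.comp φ.injective), ?_⟩
  rw [hsum]
  have hrhs : ∑ i : Fin r, (⟪b (φ i), T (b (φ i))⟫_ℂ).re = ∑ s : J, μ s := by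
    rw [φ.sum_comp (fun s : J ↦ (⟪b s, T (b s)⟫_ℂ).re)]
    exact Finset.sum_congr rfl fun s _ ↦ re_inner_eigenvectorBasis_apply hT hd s
  rw [hrhs]
  have hsub : ∑ s : J, μ s = ∑ j, if 0 < μ j then μ j else 0 := by
    rw [← Finset.sum_filter, Finset.sum_subtype (p := fun j ↦ 0 < μ j)]
    intro j; simp
  rw [hsub]
  refine Finset.sum_le_sum fun j _ ↦ ?_
  split_ifs with h
  · calc μ j * w j ≤ μ j * 1 := mul_le_mul_of_nonneg_left (hw1 j) h.le
      _ = μ j := mul_one _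
  · exact mul_nonpos_of_nonpos_of_nonneg (not_lt.1 h) (hw0 j) |>.trans le_rfl

end Core

/-! ## Representing a conjugate-symmetric form on a finite-dimensional subspace -/

section Form

variable {E : Type*} [AddCommGroup E]

/-- A conjugate-symmetric form, linear in its second argument, is conjugate-linear in its first. [folklore] -/
theorem form_add_left (s : E → E → ℂ) (hs_add : ∀ x y z, s x (y + z) = s x y + s x z)
    (hs_symm : ∀ x y, s y x = conj (s x y)) (x y z : E) : s (x + y) z = s x z + s y z := by
  rw [hs_symm z (x + y), hs_add, map_add, ← hs_symm, ← hs_symm]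

variable [Module ℂ E]

/-- Conjugate homogeneity in the first argument. [folklore] -/
theorem form_smul_left (s : E → E → ℂ) (hs_smul : ∀ (c : ℂ) x y, s x (c • y) = c * s x y)
    (hs_symm : ∀ x y, s y x = conj (s x y)) (c : ℂ) (x y : E) : s (c • x) y = conj c * s x y := by
  rw [hs_symm y (c • x), hs_smul, map_mul, ← hs_symm]

/-- Expansion of the form in the first argument along a finite sum. [folklore] -/
theorem form_sum_smul_left (s : E → E → ℂ) (hs_add : ∀ x y z, s x (y + z) = s x y + s x z)
    (hs_smul : ∀ (c : ℂ) x y, s x (c • y) = c * s x y) (hs_symm : ∀ x y, s y x = conj (s x y))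
    {ι : Type*} (t : Finset ι) (c : ι → ℂ) (u : ι → E) (y : E) :
    s (∑ a ∈ t, c a • u a) y = ∑ a ∈ t, conj (c a) * s (u a) y := by
  classical
  induction t using Finset.induction_on with
  | empty =>
      simp only [Finset.sum_empty]
      have h0 : s 0 y = s ((0 : ℂ) • (0 : E)) y := by rw [zero_smul]
      rw [h0, form_smul_left s hs_smul hs_symm]; simp
  | insert a t ha ih =>
      rw [Finset.sum_insert ha, Finset.sum_insert ha, form_add_left s hs_add hs_symm,
        form_smul_left s hs_smul hs_symm, ih]

end Form

section Repr

variable {E : Type*} [NormedAddCommGroup E] [InnerProductSpace ℂ E]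

/-- **Riesz representation on a finite-dimensional subspace.**  A conjugate-symmetric form `s` on `E`, additive and
homogeneous in its second argument, is represented on every finite-dimensional subspace `W` by a symmetric operator:
`⟪x, T y⟫ = s x y` for `x, y ∈ W`. [folklore] -/
theorem exists_isSymmetric_inner_eq (s : E → E → ℂ) (hs_add : ∀ x y z, s x (y + z) = s x y + s x z)
    (hs_smul : ∀ (c : ℂ) x y, s x (c • y) = c * s x y) (hs_symm : ∀ x y, s y x = conj (s x y))
    (W : Submodule ℂ E) [FiniteDimensional ℂ W] :
    ∃ T : W →ₗ[ℂ] W, T.IsSymmetric ∧ ∀ x y : W, ⟪x, T y⟫_ℂ = s (x : E) (y : E) := by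
  set c := stdOrthonormalBasis ℂ W with hc
  let T : W →ₗ[ℂ] W :=
    { toFun := fun y ↦ ∑ a, s (c a : E) (y : E) • c a
      map_add' := fun y z ↦ by
        rw [← Finset.sum_add_distrib]
        refine Finset.sum_congr rfl fun a _ ↦ ?_
        rw [Submodule.coe_add, hs_add, add_smul]
      map_smul' := fun r y ↦ by
        rw [RingHom.id_apply, Finset.smul_sum]
        refine Finset.sum_congr rfl fun a _ ↦ ?_
        rw [Submodule.coe_smul, hs_smul, smul_smul] }
  have hT : ∀ x y : W, ⟪x, T y⟫_ℂ = s (x : E) (y : E) := fun x y ↦ by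
    change ⟪x, ∑ a, s (c a : E) (y : E) • c a⟫_ℂ = _
    rw [inner_sum]
    simp_rw [inner_smul_right]
    -- expand `x` in the basis `c` inside `s`
    have hx : (x : E) = ∑ a, ⟪c a, x⟫_ℂ • (c a : E) := by
      conv_lhs => rw [← c.sum_repr x]
      rw [Submodule.coe_sum]
      refine Finset.sum_congr rfl fun a _ ↦ ?_
      rw [Submodule.coe_smul, c.repr_apply_apply]
    rw [hx, form_sum_smul_left s hs_add hs_smul hs_symm]
    refine Finset.sum_congr rfl fun a _ ↦ ?_
    rw [inner_conj_symm, mul_comm]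
  refine ⟨T, fun x y ↦ ?_, hT⟩
  rw [← inner_conj_symm, hT, hT, ← hs_symm]

end Repr

/-! ## Frames versus orthonormal families -/

section Frame

variable {E : Type*} [NormedAddCommGroup E] [InnerProductSpace ℂ E]

/-- **Frame relaxation of a weak-trace bound.**  Let `s` be conjugate-symmetric, additive and homogeneous in its second
argument, and suppose `Σ_i Re s(e_i, e_i) ≤ C` for every finite orthonormal family of the subspace `S`.  Then
`Σ_i Re s(v_i, v_i) ≤ C` for every finite FRAME of `S` (`Σ_i |⟪v_i, x⟫|² ≤ ‖x‖²` for all `x`). [folklore] -/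
theorem frame_sum_le_of_orthonormal_sum_le (s : E → E → ℂ) (hs_add : ∀ x y z, s x (y + z) = s x y + s x z)
    (hs_smul : ∀ (c : ℂ) x y, s x (c • y) = c * s x y) (hs_symm : ∀ x y, s y x = conj (s x y))
    {S : Submodule ℂ E} {C : ℝ}
    (h : ∀ (n : ℕ) (e : Fin n → E), Orthonormal ℂ e → (∀ i, e i ∈ S) → ∑ i, (s (e i) (e i)).re ≤ C)
    {m : ℕ} {v : Fin m → E} (hv : ∀ i, v i ∈ S) (hframe : ∀ x, ∑ i, ‖⟪v i, x⟫_ℂ‖ ^ 2 ≤ ‖x‖ ^ 2) :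
    ∑ i, (s (v i) (v i)).re ≤ C := by
  set W : Submodule ℂ E := Submodule.span ℂ (Set.range v) with hW
  haveI : FiniteDimensional ℂ W := FiniteDimensional.span_of_finite ℂ (Set.finite_range v)
  have hWS : W ≤ S := Submodule.span_le.2 (Set.range_subset_iff.2 hv)
  obtain ⟨T, hTs, hT⟩ := exists_isSymmetric_inner_eq s hs_add hs_smul hs_symm W
  let v' : Fin m → W := fun i ↦ ⟨v i, Submodule.subset_span ⟨i, rfl⟩⟩
  have hframe' : ∀ x : W, ∑ i, ‖⟪v' i, x⟫_ℂ‖ ^ 2 ≤ ‖x‖ ^ 2 := fun x ↦ by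
    have h1 := hframe (x : E)
    simpa only [Submodule.coe_inner, Submodule.coe_norm] using h1
  obtain ⟨r, e, he, hle⟩ := exists_orthonormal_sum_ge_of_frame hTs v' hframe'
  have hlhs : ∑ i, (s (v i) (v i)).re = ∑ i, (⟪v' i, T (v' i)⟫_ℂ).re :=
    Finset.sum_congr rfl fun i _ ↦ by rw [hT]
  have hrhs : ∑ j, (⟪e j, T (e j)⟫_ℂ).re = ∑ j, (s (e j : E) (e j : E)).re :=
    Finset.sum_congr rfl fun j _ ↦ by rw [hT]
  have hON : Orthonormal ℂ (fun j ↦ (e j : E)) := he.comp_linearIsometry W.subtypeₗᵢ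
  have hmem : ∀ j, (e j : E) ∈ S := fun j ↦ hWS (e j).2
  calc ∑ i, (s (v i) (v i)).re = ∑ i, (⟪v' i, T (v' i)⟫_ℂ).re := hlhs
    _ ≤ ∑ j, (⟪e j, T (e j)⟫_ℂ).re := hle
    _ = ∑ j, (s (e j : E) (e j : E)).re := hrhs
    _ ≤ C := h r _ hON hmem

/-- **Gershgorin row test ⇒ frame.**  If the Gram matrix of `v_1, …, v_m` satisfies `Σ_j |⟪v_i, v_j⟫| ≤ 1` for
every `i`, then `‖Σ_i c_i v_i‖² ≤ Σ_i |c_i|²` for all coefficients, hence `Σ_i |⟪v_i, x⟫|² ≤ ‖x‖²` for all `x`.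
[folklore] -/
theorem frame_of_gershgorin {m : ℕ} {v : Fin m → E} (hG : ∀ i, ∑ j, ‖⟪v i, v j⟫_ℂ‖ ≤ 1) (x : E) :
    ∑ i, ‖⟪v i, x⟫_ℂ‖ ^ 2 ≤ ‖x‖ ^ 2 := by
  -- Step 1: the synthesis bound `‖Σ c_i v_i‖² ≤ Σ |c_i|²`
  have hsyn : ∀ c : Fin m → ℂ, ‖∑ i, c i • v i‖ ^ 2 ≤ ∑ i, ‖c i‖ ^ 2 := fun c ↦ by
    have hexp : ‖∑ i, c i • v i‖ ^ 2 = (∑ i, ∑ j, conj (c i) * c j * ⟪v i, v j⟫_ℂ).re := by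
      rw [← inner_self_eq_norm_sq (𝕜 := ℂ), RCLike.re_to_complex, sum_inner]
      congr 1
      refine Finset.sum_congr rfl fun i _ ↦ ?_
      rw [inner_sum]
      refine Finset.sum_congr rfl fun j _ ↦ ?_
      rw [inner_smul_left, inner_smul_right]; ring
    rw [hexp, Complex.re_sum]
    have hterm : ∀ i, (∑ j, conj (c i) * c j * ⟪v i, v j⟫_ℂ).re
        ≤ ∑ j, (‖c i‖ ^ 2 + ‖c j‖ ^ 2) / 2 * ‖⟪v i, v j⟫_ℂ‖ := fun i ↦ by
      rw [Complex.re_sum]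
      refine Finset.sum_le_sum fun j _ ↦ ?_
      calc (conj (c i) * c j * ⟪v i, v j⟫_ℂ).re ≤ ‖conj (c i) * c j * ⟪v i, v j⟫_ℂ‖ := Complex.re_le_norm _
        _ = ‖c i‖ * ‖c j‖ * ‖⟪v i, v j⟫_ℂ‖ := by rw [norm_mul, norm_mul, Complex.norm_conj]
        _ ≤ (‖c i‖ ^ 2 + ‖c j‖ ^ 2) / 2 * ‖⟪v i, v j⟫_ℂ‖ := by
            apply mul_le_mul_of_nonneg_right _ (norm_nonneg _)
            nlinarith [sq_nonneg (‖c i‖ - ‖c j‖)]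
    refine (Finset.sum_le_sum fun i _ ↦ hterm i).trans ?_
    -- symmetrise: Σ_i Σ_j (a_i + a_j)/2 · g_ij = Σ_i a_i Σ_j g_ij  (g symmetric)
    have hsymm : ∀ i j, ‖⟪v i, v j⟫_ℂ‖ = ‖⟪v j, v i⟫_ℂ‖ := fun i j ↦ by
      rw [← inner_conj_symm, Complex.norm_conj]
    have hsplit : ∑ i, ∑ j, (‖c i‖ ^ 2 + ‖c j‖ ^ 2) / 2 * ‖⟪v i, v j⟫_ℂ‖
        = ∑ i, ‖c i‖ ^ 2 * ∑ j, ‖⟪v i, v j⟫_ℂ‖ := by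
      have e1 : ∑ i, ∑ j, (‖c i‖ ^ 2 + ‖c j‖ ^ 2) / 2 * ‖⟪v i, v j⟫_ℂ‖
          = ∑ i, ∑ j, ‖c i‖ ^ 2 / 2 * ‖⟪v i, v j⟫_ℂ‖ + ∑ i, ∑ j, ‖c j‖ ^ 2 / 2 * ‖⟪v i, v j⟫_ℂ‖ := by
        rw [← Finset.sum_add_distrib]
        refine Finset.sum_congr rfl fun i _ ↦ ?_
        rw [← Finset.sum_add_distrib]
        refine Finset.sum_congr rfl fun j _ ↦ by ring
      have e2 : ∑ i, ∑ j, ‖c j‖ ^ 2 / 2 * ‖⟪v i, v j⟫_ℂ‖ = ∑ i, ∑ j, ‖c i‖ ^ 2 / 2 * ‖⟪v i, v j⟫_ℂ‖ := by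
        rw [Finset.sum_comm]
        refine Finset.sum_congr rfl fun i _ ↦ Finset.sum_congr rfl fun j _ ↦ by rw [hsymm]
      rw [e1, e2, ← Finset.sum_add_distrib]
      refine Finset.sum_congr rfl fun i _ ↦ ?_
      rw [← Finset.sum_add_distrib, Finset.mul_sum]
      refine Finset.sum_congr rfl fun j _ ↦ by ring
    rw [hsplit]
    refine Finset.sum_le_sum fun i _ ↦ ?_
    calc ‖c i‖ ^ 2 * ∑ j, ‖⟪v i, v j⟫_ℂ‖ ≤ ‖c i‖ ^ 2 * 1 :=
          mul_le_mul_of_nonneg_left (hG i) (by positivity)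
      _ = ‖c i‖ ^ 2 := mul_one _
  -- Step 2: analysis bound by duality, with `c_i = ⟪v_i, x⟫`
  set c : Fin m → ℂ := fun i ↦ ⟪v i, x⟫_ℂ with hc
  set A : ℝ := ∑ i, ‖c i‖ ^ 2 with hA
  have hA0 : 0 ≤ A := Finset.sum_nonneg fun i _ ↦ by positivity
  have hkey : A = (⟪∑ i, c i • v i, x⟫_ℂ).re := by
    rw [sum_inner, Complex.re_sum]
    refine Finset.sum_congr rfl fun i _ ↦ ?_
    rw [inner_smul_left, hc]
    simp only
    rw [Complex.conj_mul' ]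
    norm_cast
  have hle : A ≤ Real.sqrt A * ‖x‖ := by
    calc A = (⟪∑ i, c i • v i, x⟫_ℂ).re := hkey
      _ ≤ ‖⟪∑ i, c i • v i, x⟫_ℂ‖ := Complex.re_le_norm _
      _ ≤ ‖∑ i, c i • v i‖ * ‖x‖ := norm_inner_le_norm _ _
      _ ≤ Real.sqrt A * ‖x‖ := by
          apply mul_le_mul_of_nonneg_right _ (norm_nonneg _)
          rw [← Real.sqrt_sq (norm_nonneg _)]
          exact Real.sqrt_le_sqrt (hsyn c)
  -- conclude `A ≤ ‖x‖²`
  have hsq : Real.sqrt A * Real.sqrt A = A := Real.mul_self_sqrt hA0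
  by_cases hA1 : A = 0
  · rw [hA1]; positivity
  · have hApos : 0 < Real.sqrt A := Real.sqrt_pos.2 (lt_of_le_of_ne hA0 (Ne.symm hA1))
    have h3 : Real.sqrt A ≤ ‖x‖ := by
      have := hle
      rw [← hsq] at this
      exact le_of_mul_le_mul_left (by linarith) hApos
    calc A = Real.sqrt A ^ 2 := by rw [sq, hsq]
      _ ≤ ‖x‖ ^ 2 := pow_le_pow_left₀ hApos.le h3 2

end Frame

end Summit.RiemannHypothesis.RiemannHypothesis.SoninFrame

end
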